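import Summits.ResolutionOfSingularities.ResolutionOfSingularities.Theorems.DeltaCutStellarLatJRound

/-!
# StellarCut J21c — «LatJet»: the Artin–Schreier FIBRE GUARD and the ROUND LEMMA for the latent-jet class (lens-6, g36 door 2)

The guard `supp M' ⊆ V(H')` of a latent hop does not involve the derivation: it is L20c's Artin–Schreier argument (fibre form
`X₀ᵖ + α·X₀X₁^{p−1} + αγ·X₁ᵖ`, chart guard `latentForm_notMem_sq` from `p = 0`, T10c's near-fibre bound).  L20c's lemmas are keyed on
L20a's class `ncHypShapeLat`, whose coprime clause the latent-jet class DROPS; this file re-instantiates the three keyed steps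
(`exists_fibre_data`, `not_stalkIdeal_transform_le_sq`, `support_transform_subset`) and the mass count for `ncHypShapeLatJ` — the
proofs are L20c's VERBATIM over the new accessors (declared 0-weight copies) — and assembles the hyp-free ROUND LEMMA
`ncHypShapeLatJ.transform` with J21b's datum transport.

0 sorry; axioms standard. [new] [cite: CossartPiltant2008, Prop. 4.2 (a)] [cite: Kollar2007, (3.111) Step 3]
-/
noncomputable section

open CategoryTheory CategoryTheory.Limits AlgebraicGeometry TopologicalSpace IsLocalRing
open Literature.AlgebraicGeometry.Resolution

namespace Summit.ResolutionOfSingularities.ResolutionOfSingularities.Theorems.DeltaCutClasses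

open Summit.ResolutionOfSingularities.ResolutionOfSingularities.Theorems
open WeakOrderReduction ForcedTowerClasses MvPolynomial

/-! ### §Fibre — the fibre form and the guard, latent-jet class -/

section Fibre

variable {X X' : Scheme.{0}} [IsLocallyNoetherian X] {π : X' ⟶ X} {H K : X.IdealSheafData}
  {E L : List (X.IdealSheafData × ℕ)} {p : ℕ} {M : MarkedIdeal X}

omit [IsLocallyNoetherian X] in
/-- **FIBRE DATA at a point of the latent face** `C = V(H) ∩ V(K)` (L20c's computation re-instantiated for the latent-jet class;
`H ≠ K`, `expOf L K ≥ 1`): centre parameters `c` (an rsop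
pair spanning `C_y`, `H_y = (c 0)`) and `α, γ ∈ 𝒪_y` with `F(c) ∈ 𝓘_y` for the fibre form `F = X₀ᵖ + αX₀X₁^{p−1} + αγX₁ᵖ`
(`F(c) = wᵖ·(hᵖ + v(h − c m_μ) m_b m_μ^{p−1})`, `h w = c₀`, the monomials split along `z_K = c₁`). [new]
[cite: CossartPiltant2008, proof of Prop. 4.2 (a)] [cite: Kollar2007, (3.111) Step 3] -/
theorem ncHypShapeLatJ.exists_fibre_data (hEs : HasSNC (H :: boundaryOf E)) (hK : K ∈ boundaryOf E) (hHK : H ≠ K)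
    (hLK : 1 ≤ expOf L K) (hP : ncHypShapeLatJ p X E L H M) {y : X} (hy : y ∈ (((pairFace H K).sup id).support : Set X)) :
    ∃ (c : Fin 2 → X.presheaf.stalk y) (α γ : X.presheaf.stalk y), IsRsopPart c ∧
      Ideal.span (Set.range c) = stalkIdeal ((pairFace H K).sup id) y ∧ stalkIdeal H y = Ideal.span {c 0} ∧
      MvPolynomial.eval c (latentForm p α (α * γ)) ∈ stalkIdeal M.ideal y := by
  classical
  haveI : IsRegularLocalRing (X.presheaf.stalk y) := (hEs y).1
  haveI : IsDomain (X.presheaf.stalk y) := isDomain_of_isRegularLocalRing _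
  have hyT : ∀ K' ∈ pairFace H K, y ∈ K'.support := (mem_support_finsetSup_iff _ y).mp hy
  have hyH : y ∈ H.support := hyT H left_mem_pairFace
  have hyK : y ∈ K.support := hyT K right_mem_pairFace
  have hKEs : K ∈ H :: boundaryOf E := List.mem_cons_of_mem _ hK
  obtain ⟨d, z, lab, hz, hlab, hinj⟩ := exists_isRsopPart_lab hEs List.mem_cons_self hyH
  have hlabne : lab H ≠ lab K := fun h => hHK (hinj H List.mem_cons_self K hKEs hyH hyK h)
  obtain ⟨e, he0, he1⟩ : ∃ e : Fin 2 → Fin d, e 0 = lab H ∧ e 1 = lab K := ⟨![lab H, lab K], rfl, rfl⟩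
  have he : Function.Injective e :=
    Fin.forall_fin_two.mpr ⟨Fin.forall_fin_two.mpr ⟨fun _ => rfl, fun h => absurd (he0.symm.trans (h.trans he1)) hlabne⟩,
      Fin.forall_fin_two.mpr ⟨fun h => absurd (he0.symm.trans (h.symm.trans he1)) hlabne, fun _ => rfl⟩⟩
  have hc0 : (z ∘ e) 0 = z (lab H) := by rw [Function.comp_apply, he0]
  have hc1 : (z ∘ e) 1 = z (lab K) := by rw [Function.comp_apply, he1]
  have hH0 : stalkIdeal H y = Ideal.span {(z ∘ e) 0} := by rw [hc0]; exact hlab H List.mem_cons_self hyH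
  have hK0 : stalkIdeal K y = Ideal.span {(z ∘ e) 1} := by rw [hc1]; exact hlab K hKEs hyK
  have hspan : Ideal.span (Set.range (z ∘ e)) = stalkIdeal ((pairFace H K).sup id) y := by
    rw [latRange_fin_two, stalkIdeal_finsetSup _ y, pairFace_eq_insert]
    simp only [Finset.sup_insert, Finset.sup_singleton]
    rw [hH0, hK0, Ideal.span_insert]
  -- the generators and the labelled products
  obtain ⟨h, mb, mμ, cc, v, -, -, hHx, hbx, hμx, hIx⟩ := hP.exists_generator hyH
  obtain ⟨w, hw⟩ := Ideal.span_singleton_eq_span_singleton.mp (hHx.symm.trans hH0)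
  have hE : ∀ q ∈ E, q.1 ∈ H :: boundaryOf E := fun q hq => List.mem_cons_of_mem _ (fst_mem_boundaryOf hq)
  have hL : ∀ q ∈ L, q.1 ∈ H :: boundaryOf E := fun q hq =>
    List.mem_cons_of_mem _ (hP.boundaryOf_eq ▸ fst_mem_boundaryOf hq)
  have hg : ∀ F : List (X.IdealSheafData × ℕ), ∀ q ∈ F, q.1 = K →
      (fun q : X.IdealSheafData × ℕ => if y ∈ q.1.support then z (lab q.1) ^ q.2 else 1) q = (z ∘ e) 1 ^ q.2 := by
    intro F q _ hqK
    simp only [Function.comp_apply, hqK, if_pos hyK, he1]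
  obtain ⟨wb, hwb⟩ := Ideal.span_singleton_eq_span_singleton.mp
    (hbx.symm.trans (stalkIdeal_monomialIdeal_eq_span_prod hlab E hE))
  obtain ⟨wμ, hwμ⟩ := Ideal.span_singleton_eq_span_singleton.mp
    (hμx.symm.trans (stalkIdeal_monomialIdeal_eq_span_prod hlab L hL))
  rw [prod_map_eq_pow_expOf_mul E K _ ((z ∘ e) 1) (hg E)] at hwb
  rw [prod_map_eq_pow_expOf_mul L K _ ((z ∘ e) 1) (hg L)] at hwμ
  -- normal forms: `h = c₀ w⁻¹`, `m_b = c₁^{b_K}·P_E·w_b⁻¹`, `m_μ = c₁·c₁^{m}·P_L·w_μ⁻¹` (`expOf L K = m + 1`)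
  set PE := (E.map fun q => if q.1 = K then 1 else
    (fun q : X.IdealSheafData × ℕ => if y ∈ q.1.support then z (lab q.1) ^ q.2 else 1) q).prod with hPE
  set PL := (L.map fun q => if q.1 = K then 1 else
    (fun q : X.IdealSheafData × ℕ => if y ∈ q.1.support then z (lab q.1) ^ q.2 else 1) q).prod with hPL
  obtain ⟨m, hm⟩ : ∃ m, expOf L K = m + 1 := ⟨expOf L K - 1, by omega⟩
  obtain ⟨q, rfl⟩ : ∃ q, p = q + 1 := ⟨p - 1, by have := hP.prime.one_lt; omega⟩
  have hmb : mb = (z ∘ e) 1 ^ expOf E K * PE * ↑wb⁻¹ := by rw [← hwb, Units.mul_inv_cancel_right]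
  have hmμ : mμ = (z ∘ e) 1 * (z ∘ e) 1 ^ m * PL * ↑wμ⁻¹ := by
    rw [← pow_succ', ← hm, ← hwμ, Units.mul_inv_cancel_right]
  refine ⟨z ∘ e, ↑w ^ q * v * ↑wb⁻¹ * ↑wμ⁻¹ ^ q * PE * PL ^ q * (z ∘ e) 1 ^ expOf E K * ((z ∘ e) 1 ^ m) ^ q,
    -(↑w * cc * ↑wμ⁻¹ * PL * (z ∘ e) 1 ^ m), hz.comp e he, hspan, hH0, ?_⟩
  have hkey : MvPolynomial.eval (z ∘ e) (latentForm (q + 1)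
      (↑w ^ q * v * ↑wb⁻¹ * ↑wμ⁻¹ ^ q * PE * PL ^ q * (z ∘ e) 1 ^ expOf E K * ((z ∘ e) 1 ^ m) ^ q)
      (↑w ^ q * v * ↑wb⁻¹ * ↑wμ⁻¹ ^ q * PE * PL ^ q * (z ∘ e) 1 ^ expOf E K * ((z ∘ e) 1 ^ m) ^ q *
        -(↑w * cc * ↑wμ⁻¹ * PL * (z ∘ e) 1 ^ m))) =
      ↑w ^ (q + 1) * (h ^ (q + 1) + v * (h - cc * mμ) * mb * mμ ^ (q + 1 - 1)) := by
    simp only [latentForm, map_add, map_mul, map_pow, MvPolynomial.eval_X, MvPolynomial.eval_C, Nat.add_sub_cancel]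
    rw [hmb, hmμ, ← hw]
    ring
  rw [hkey, hIx]
  exact Ideal.mul_mem_left _ _ (Ideal.mem_span_singleton_self _)

/-- **`𝓘'_{x'} ⊄ 𝔪²` OVER THE CENTRE OFF `V(H')`** after the latent hop (latent-jet class): T10c fed with the fibre form and the Artin–Schreier chart
guard. [new] [cite: CossartPiltant2008, Prop. 4.2 (a)] [cite: Kollar2007, (3.111) Step 3] -/
theorem ncHypShapeLatJ.not_stalkIdeal_transform_le_sq (hEs : HasSNC (H :: boundaryOf E)) (hK : K ∈ boundaryOf E) (hHK : H ≠ K)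
    (hπ : IsBlowup π ((pairFace H K).sup id)) (hLK : 1 ≤ expOf L K) (hP : ncHypShapeLatJ p X E L H M) {x' : X'}
    (hxC : π x' ∈ (((pairFace H K).sup id).support : Set X))
    (hx' : x' ∉ (strictTransformIdeal π ((pairFace H K).sup id) H).support) :
    ¬ stalkIdeal (M.transform π ((pairFace H K).sup id)).ideal x' ≤ maximalIdeal (X'.presheaf.stalk x') ^ 2 := by
  classical
  haveI : IsProper π := hπ.isProper
  haveI : IsLocallyNoetherian X' := LocallyOfFiniteType.isLocallyNoetherian π
  obtain ⟨c, α, γ, hc, hcspan, hHc, hFJ⟩ := hP.exists_fibre_data hEs hK hHK hLK hxC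
  rw [MarkedIdeal.transform_ideal, hP.mult_eq]
  refine IsBlowup.not_stalkIdeal_controlledTransform_le_pow_of_fibre hπ c hcspan (IsRsopPart.isQuasiRegular' hc)
    (IsRsopPart.mem_maximalIdeal hc) (isHomogeneous_latentForm hP.prime.one_lt.le α (α * γ)) hFJ 2 {0} (fun l hl => ?_)
    fun j 𝔮 _ h𝔮 => latentForm_notMem_sq hP.prime.two_le (hP.cast_eq_zero (π x')) α γ j 𝔮 h𝔮
  rw [Set.mem_singleton_iff.mp hl]
  exact map_stalkIdeal_finsetSup_eq_span_of_not_mem hEs (pair_subset_frame hK) left_mem_pairFace hπ hx' hHc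

/-- **THE GUARD `supp M' ⊆ V(H')` of the latent hop, latent-jet class** (off the centre: local isomorphism and `supp M ⊆ V(H)` lifts; over the
centre: the Artin–Schreier guard). [new] [cite: CossartPiltant2008, Prop. 4.2 (a)] -/
theorem ncHypShapeLatJ.support_transform_subset (hEs : HasSNC (H :: boundaryOf E)) (hK : K ∈ boundaryOf E) (hHK : H ≠ K)
    (hπ : IsBlowup π ((pairFace H K).sup id)) (hLK : 1 ≤ expOf L K) (hP : ncHypShapeLatJ p X E L H M) :
    (M.transform π ((pairFace H K).sup id)).support ⊆
      ((strictTransformIdeal π ((pairFace H K).sup id) H).support : Set X') := by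
  haveI : IsProper π := hπ.isProper
  haveI : IsLocallyNoetherian X' := LocallyOfFiniteType.isLocallyNoetherian π
  intro x' hx'
  have hx'' : x' ∈ (M.transform π ((pairFace H K).sup id)).support := hx'
  by_cases hxC : π x' ∈ (((pairFace H K).sup id).support : Set X)
  · by_contra hxH
    refine hP.not_stalkIdeal_transform_le_sq hEs hK hHK hπ hLK hxC hxH ?_
    have h := (MarkedIdeal.mem_support_iff _ _).mp hx''
    rw [MarkedIdeal.transform_mult, hP.mult_eq] at h
    exact h.trans (Ideal.pow_le_pow_right hP.prime.two_le)
  · exact mem_support_strictTransformIdeal_of_not_mem hxC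
      (hP.support_subset ((hπ.mem_support_transform_iff_of_not_mem M hxC).mp hx''))

/-- ★ **THE LATENT-JET ROUND LEMMA**: the latent-jet shape (presentation AND eigen-datum, J21b) survives the blow-up of the
latent face `{H, K}` (`H ≠ K ∈ ∂E`, `expOf L K ≥ 1`) — terminal labels at marking `0`, latent labels at marking `1` — for every residue field. [new]
[cite: CossartPiltant2008, Prop. 4.2 (a)] [cite: Kollar2007, (3.111) Step 3] -/
theorem ncHypShapeLatJ.transform (hEs : HasSNC (H :: boundaryOf E)) (hK : K ∈ boundaryOf E) (hHK : H ≠ K)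
    (hπ : IsBlowup π ((pairFace H K).sup id)) (hLK : 1 ≤ expOf L K) (hP : ncHypShapeLatJ p X E L H M) :
    ncHypShapeLatJ p X' (transformExp E π (pairFace H K) 0) (transformExp L π (pairFace H K) 1)
      (strictTransformIdeal π ((pairFace H K).sup id) H) (M.transform π ((pairFace H K).sup id)) :=
  hP.transform_of_support_subset hEs hK hHK hπ hLK (hP.support_transform_subset hEs hK hHK hπ hLK)

end Fibre

/-! ### §Mass — the latent mass drops under the hop (latent-jet class) -/

section Mass

variable {X X' : Scheme.{0}} [IsLocallyNoetherian X] {π : X' ⟶ X} {H K : X.IdealSheafData}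
  {E L : List (X.IdealSheafData × ℕ)} {p : ℕ} {M : MarkedIdeal X}

open Classical in
/-- ★ **THE LATENT MASS DROPS under the hop at `{H, K}`** (latent-jet class; L20c's count) (`expOf L K ≥ 1`,
`V(K) ∩ V(H) ≠ ∅`): the strict transform of `K` no longer meets `V(H')` (its whole label leaves the mass), every other strict
transform meets `V(H')` only if its image met `V(H)`, and the new exceptional member carries `expOf L K − 1`. [new] -/
theorem ncHypShapeLatJ.latMass_transform_lt (hEs : HasSNC (H :: boundaryOf E)) (hK : K ∈ boundaryOf E) (hHK : H ≠ K)
    (hπ : IsBlowup π ((pairFace H K).sup id)) (hP : ncHypShapeLatJ p X E L H M) (hLK : 1 ≤ expOf L K)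
    (hne : ((K.support : Set X) ∩ H.support).Nonempty) :
    latMass (transformExp L π (pairFace H K) 1) (strictTransformIdeal π ((pairFace H K).sup id) H) < latMass L H := by
  haveI : IsProper π := hπ.isProper
  haveI : IsLocallyNoetherian X' := LocallyOfFiniteType.isLocallyNoetherian π
  obtain ⟨y₀, hy₀K, hy₀H⟩ := hne
  have hw : weightOf L (pairFace H K) = expOf L K := by rw [weightOf_pairFace hHK, hP.expOfL_eq_zero hy₀H, zero_add]
  simp only [latMass, transformExp, List.map_append, List.map_map, List.sum_append, List.map_cons, List.map_nil, List.sum_cons,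
    List.sum_nil, add_zero]
  -- (1) on `L`: `f'(strict q) + [q.1 = K]·q.2 ≤ g q`, summed
  have h1 : (L.map ((fun q : X'.IdealSheafData × ℕ => if ((q.1.support : Set X') ∩
      (strictTransformIdeal π ((pairFace H K).sup id) H).support).Nonempty then q.2 else 0) ∘
        fun q : X.IdealSheafData × ℕ => (strictTransformIdeal π ((pairFace H K).sup id) q.1, q.2))).sum + expOf L K ≤
      (L.map fun q => if ((q.1.support : Set X) ∩ H.support).Nonempty then q.2 else 0).sum := by
    rw [← sum_map_ite_eq_expOf L K, ← List.sum_map_add]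
    refine List.sum_le_sum fun q hq => ?_
    simp only [Function.comp_apply]
    by_cases hqK : q.1 = K
    · -- the strict transform of `K` misses `V(H')`; `V(K)` meets `V(H)` at `y₀`
      have hemp : ¬ (((strictTransformIdeal π ((pairFace H K).sup id) q.1).support : Set X') ∩
          (strictTransformIdeal π ((pairFace H K).sup id) H).support).Nonempty := by
        rintro ⟨x', hxK, hxH⟩
        rw [hqK] at hxK
        exact not_mem_support_strict_pair hEs hK hπ hxH hxK
      have hyes : ((q.1.support : Set X) ∩ H.support).Nonempty := ⟨y₀, by rw [hqK]; exact hy₀K, hy₀H⟩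
      rw [if_neg hemp, if_pos hqK, if_pos hyes, zero_add]
    · rw [if_neg hqK, add_zero]
      by_cases hN : (((strictTransformIdeal π ((pairFace H K).sup id) q.1).support : Set X') ∩
          (strictTransformIdeal π ((pairFace H K).sup id) H).support).Nonempty
      · obtain ⟨x', hxq, hxH⟩ := hN
        rw [if_pos ⟨x', hxq, hxH⟩, if_pos ⟨π x', mem_support_of_mem_support_strictTransformIdeal hxq,
          mem_support_of_mem_support_strictTransformIdeal hxH⟩]
      · rw [if_neg hN]
        exact Nat.zero_le _
  -- (2) the exceptional member carries at most `weightOf L {H,K} − 1 = expOf L K − 1`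
  split_ifs <;> omega

end Mass

end Summit.ResolutionOfSingularities.ResolutionOfSingularities.Theorems.DeltaCutClasses

end
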